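import Summits.ValiantsHypothesis.ValiantsHypothesis.Theorems.SymPencilSymmetrizePermPairsSmallIndexPairs
import HarnessLib

/-!
# ValiantsHypothesis / SymPencil — crux `SymmetrizePermPairs` (stmt-ValiantsHypothesis-17793), line
# `birth_SymmetrizePermPairs`, stub `stub_induce`, small-index regime: preliminaries of the assembly
# (arithmetic; Dixon–Mortimer for both projections)

Helper of the item (`--supports stmt-ValiantsHypothesis-17793 --as helper`; 0 definitions, 0 named
facts).  Bookkeeping for `SmallIndex.permEmbeddingD_sub` (`…SmallIndexAssembly.lean`):
* arithmetic of the small-index regime (`2^k ≤ C(n,k)` is the tree's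
  `PolyaContinued.MonotoneCoverHardRectangle.two_pow_le_choose`): `two_pow_pred_le_factorial`, `linear_le_two_pow`, `log_bound` (`32 log₂ n + 40 ≤ n`, `n ≥ 512`),
  `card_perm_sq_lt` (`|𝔖_n|² < 2^{2n(log₂ n+1)}`), `four_kzero_le` (`4(log₂ R + 1) ≤ n` in the regime);
(Dixon–Mortimer for both projections is p6 g12's landed `SmallIndex.prod_altFixing_le_of_small_index`,
`…ProjectionsAlternating.lean`, used by the assembly directly.)

Honest framing: bookkeeping; `stub_induce`, the crux `SymPencil.SymmetrizePermPairs` and `VP ≠ VNP`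
remain OPEN and nothing here is progress on them.
-/

noncomputable section

set_option linter.dupNamespace false

namespace Summit.ValiantsHypothesis.ValiantsHypothesis.Theorems.SymPencilEquivariantSdcNotQP.SmallIndex

open Equiv

/-! ## Arithmetic of the small-index regime -/

/-- `2^{m-1} ≤ m!`. [folklore] -/
theorem two_pow_pred_le_factorial : ∀ m : ℕ, 2 ^ (m - 1) ≤ m.factorial := by
  intro m
  induction m with
  | zero => simp
  | succ m ih =>
    rcases Nat.eq_zero_or_pos m with rfl | hm
    · simp
    · rw [Nat.factorial_succ, show m + 1 - 1 = (m - 1) + 1 by omega, pow_succ]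
      calc 2 ^ (m - 1) * 2 ≤ m.factorial * 2 := Nat.mul_le_mul_right _ ih
        _ ≤ m.factorial * (m + 1) := Nat.mul_le_mul_left _ (by omega)
        _ = (m + 1) * m.factorial := by ring

/-- `32 j + 40 ≤ 2^j` for `j ≥ 9`. [folklore] -/
theorem linear_le_two_pow {j : ℕ} (hj : 9 ≤ j) : 32 * j + 40 ≤ 2 ^ j := by
  induction j, hj using Nat.le_induction with
  | base => norm_num
  | succ j hj ih =>
    have h32 : 32 ≤ 2 ^ j := by
      calc (32 : ℕ) = 2 ^ 5 := by norm_num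
        _ ≤ 2 ^ j := Nat.pow_le_pow_right (by norm_num) (by omega)
    rw [pow_succ]
    omega

/-- `32 log₂ n + 40 ≤ n` for `n ≥ 512`. [folklore] -/
theorem log_bound {n : ℕ} (hn : 512 ≤ n) : 32 * Nat.log 2 n + 40 ≤ n := by
  have h9 : 9 ≤ Nat.log 2 n := Nat.le_log_of_pow_le (by norm_num) (by norm_num; omega)
  exact (linear_le_two_pow h9).trans (Nat.pow_log_le_self 2 (by omega))

/-- `|𝔖_n × 𝔖_n| < 2^{2n(log₂ n + 1)}` (for `n ≥ 1`). [folklore] -/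
theorem card_perm_sq_lt {n : ℕ} (hn : 1 ≤ n) :
    Nat.card (Perm (Fin n) × Perm (Fin n)) < 2 ^ (2 * n * (Nat.log 2 n + 1)) := by
  have hn2 : n < 2 ^ (Nat.log 2 n + 1) := Nat.lt_pow_succ_log_self one_lt_two n
  have hfact : n.factorial < 2 ^ (n * (Nat.log 2 n + 1)) := by
    calc n.factorial ≤ n ^ n := Nat.factorial_le_pow n
      _ < (2 ^ (Nat.log 2 n + 1)) ^ n := Nat.pow_lt_pow_left hn2 (by omega)
      _ = 2 ^ (n * (Nat.log 2 n + 1)) := by rw [← pow_mul, mul_comm]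
  rw [Nat.card_prod, Nat.card_perm, Nat.card_eq_fintype_card, Fintype.card_fin,
    show 2 * n * (Nat.log 2 n + 1) = n * (Nat.log 2 n + 1) + n * (Nat.log 2 n + 1) by ring, pow_add]
  exact Nat.mul_lt_mul'' hfact hfact

/-- The numerics of the small-index regime: `n ≥ 512` and `(log₂ R)² < 2n(log₂ n + 1)` give, for
`k₀ = log₂ R + 1`: `4k₀ ≤ n`. [folklore] -/
theorem four_kzero_le {n R : ℕ} (hn : 512 ≤ n)
    (hR : (Nat.log 2 R) ^ 2 < 2 * n * (Nat.log 2 n + 1)) : 4 * (Nat.log 2 R + 1) ≤ n := by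
  have hlog := log_bound hn
  set x := Nat.log 2 R with hx
  set y := Nat.log 2 n with hy
  have hA : 16 * x ^ 2 < 32 * n * (y + 1) := by
    have := Nat.mul_lt_mul_of_pos_left hR (by norm_num : 0 < 16)
    linarith [this]
  have hB : 32 * n * (y + 1) + 8 * n ≤ n * n := by
    have : n * (32 * (y + 1) + 8) ≤ n * n := Nat.mul_le_mul_left _ (by omega)
    linarith [this]
  have key : 16 * x ^ 2 + 8 * n < n * n := by omega
  by_contra hcon
  push Not at hcon
  have h3 : 3 ≤ n := by omega
  zify at key hcon h3
  nlinarith [mul_nonneg (by linarith : (0 : ℤ) ≤ 4 * x + 3 - n) (by linarith : (0 : ℤ) ≤ 4 * x + n - 3)]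



end Summit.ValiantsHypothesis.ValiantsHypothesis.Theorems.SymPencilEquivariantSdcNotQP.SmallIndex

end
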